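import Literature.MathematicalPhysics.QuantumLattice.DWaveSourceEnergyDensityTwoStateClasses
import Literature.MathematicalPhysics.QuantumLattice.CanonicalClassChemicalPotential
import HarnessLib

/-!
# Fenchel–Moreau at every source: the canonical-class sourced energy density at an interior filling is
# ATTAINED as the maximum over chemical potentials of the grand-canonical torus-limit energy density

Topic `Literature/MathematicalPhysics/QuantumLattice` (family `hubbard`); sequel of
`DWaveSourceEnergyDensityTwoStateClasses.lean` (weak duality `e_src(t',U,μ,h) + μρ ≤ E_ρ(t',U,h)` at every
realised density and `e_src(t',U,μ,h) = inf_ρ (E_ρ(t',U,h) − μρ)`, where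
`E_ρ(t',U,h) = tiGroundEnergyDensityAt (hubbardTTPrimeSourcedInteraction 1 t' U 0 dWaveFormFactor h) 1 ρ` is the
canonical-class value — translation-invariant states of density `ρ` — and `e_src = dWaveSourceEnergyDensityTT'`
the grand-canonical torus-limit value). Here the converse direction:

* §1 the set of REALISED densities `{ρ(ω) : ω translation invariant}` is convex (mixtures), contains `[0, 2)`
  and lies in `[0, 2]`; `ρ ↦ E_ρ(t',U,h)` is convex on it.
* §2 **STRONG DUALITY** (`exists_dWaveSourceEnergyDensityTT'_add_mul_eq_tiGroundEnergyDensityAt`): for every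
  interior filling `0 < ρ < 2` and every source `h` there is a chemical potential `μ` — a subgradient of the convex
  `E_·(t',U,h)` at `ρ` (`ConvexOn.exists_supporting_slope` of `CanonicalClassChemicalPotential.lean`, the
  state-level Lagrange-multiplier file) — with `e_src(t',U,μ,h) + μρ = E_ρ(t',U,h)`; hence
  `E_ρ(t',U,h) = max_μ (e_src(t',U,μ,h) + μρ)` (`isGreatest_…`). So the canonical-class number at filling `7/8`
  and field `h` IS a grand-canonical number at the right `μ`: the two state classes of the cell's chord rules carry
  the same information, source and all (Ruelle's equivalence of ensembles at `T = 0`, with the symmetry-breaking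
  field switched on).
* §3 consistency at `h = 0`: `E_ρ(t',U,0) = energyDensityTT' 1 t' U ρ` (`U ≥ 0`, `0 < ρ < 2`), so §2 at `h = 0` is
  the tree's `exists_gcEnergyDensityTT'_add_mul_eq` read through `e_src(·,0) = gcEnergyDensityTT'`.

Everything is PROVED; no definition, no named fact. HONEST SCOPE: convex bookkeeping; no number, no claim about
any ground state.

## References
* D. Ruelle, *Statistical Mechanics: Rigorous Results* (1969), §3.4 (equivalence of ensembles; Legendre
  transform in the density). [cite: Ruelle1969, §3.4]
* R. T. Rockafellar, *Convex Analysis* (1970), Thm. 23.4 (a finite convex function has a subgradient at every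
  interior point). [cite: Rockafellar1970, Thm. 23.4]
* T. Koma, H. Tasaki, J. Stat. Phys. 76 (1994) 745, §1. [cite: KomaTasaki1994, §1]
-/

noncomputable section

namespace Literature.MathematicalPhysics.QuantumLattice

open _root_.Matrix Finset HubbardWave0 Literature.Probability.LatticeModels _root_.Filter ThermodynamicLimit
open scoped _root_.Topology ComplexOrder BigOperators

/-! ### §1 The realised densities form a convex set containing `[0,2)`; `E_·` is convex on it -/

section Realised

/-- **Mixtures realise intermediate densities**: the set `{ρ(ω) : ω translation invariant}` of realised
densities on `ℤ²` is convex. [cite: Ruelle1969, §3.4] -/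
theorem convex_setOf_isTranslationInvariant_density :
    Convex ℝ {m : ℝ | ∃ ω : InfVolFermionState 2, ω.IsTranslationInvariant ∧ ω.density = m} := by
  intro x hx y hy a b ha hb hab
  obtain ⟨ω₁, hω₁, hρ₁⟩ := hx
  obtain ⟨ω₂, hω₂, hρ₂⟩ := hy
  have ha1 : a ≤ 1 := by linarith
  refine ⟨InfVolFermionState.mix a ha ha1 ω₁ ω₂, hω₁.mix hω₂ a ha ha1, ?_⟩
  rw [InfVolFermionState.density_mix, hρ₁, hρ₂, show 1 - a = b by linarith, smul_eq_mul, smul_eq_mul]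

/-- Density `0` is realised (the Fock vacuum). [cite: Ruelle1969, §3.4] -/
theorem zero_mem_setOf_isTranslationInvariant_density :
    (0 : ℝ) ∈ {m : ℝ | ∃ ω : InfVolFermionState 2, ω.IsTranslationInvariant ∧ ω.density = m} :=
  ⟨vacuumState 2, InfVolFermionState.vacuumState_isTranslationInvariant,
    InfVolFermionState.densityAt_vacuumState 0⟩

/-- Every interior density `0 < ρ < 2` is realised. [cite: Ruelle1969, §3.4] -/
theorem mem_setOf_isTranslationInvariant_density_of_Ioo {ρ : ℝ} (hρ0 : 0 < ρ) (hρ2 : ρ < 2) :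
    ρ ∈ {m : ℝ | ∃ ω : InfVolFermionState 2, ω.IsTranslationInvariant ∧ ω.density = m} :=
  exists_isTranslationInvariant_density_eq hρ0 hρ2

/-- Realised densities lie in `[0, 2]` (two spin states per site). [cite: Ruelle1969, §3.4] -/
theorem mem_Icc_of_mem_setOf_isTranslationInvariant_density {m : ℝ}
    (hm : m ∈ {m : ℝ | ∃ ω : InfVolFermionState 2, ω.IsTranslationInvariant ∧ ω.density = m}) :
    m ∈ Set.Icc (0 : ℝ) 2 := by
  obtain ⟨ω, -, rfl⟩ := hm
  exact ⟨ω.density_nonneg, ω.density_le_two⟩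

/-- **`ρ ↦ E_ρ(Ψ)` is convex on the realised densities**, for every interaction `Ψ` on `ℤ²`.
[cite: Ruelle1969, §3.4] -/
theorem FermionInteraction.convexOn_tiGroundEnergyDensityAt_realised (Ψ : FermionInteraction 2) (R : ℝ) :
    ConvexOn ℝ {m : ℝ | ∃ ω : InfVolFermionState 2, ω.IsTranslationInvariant ∧ ω.density = m}
      (Ψ.tiGroundEnergyDensityAt R) :=
  Ψ.convexOn_tiGroundEnergyDensityAt R convex_setOf_isTranslationInvariant_density fun _ h => h

end Realised

/-! ### §2 Strong duality: a subgradient chemical potential at every interior filling and every source -/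

section StrongDuality

variable (t' U h : ℝ)

/-- **STRONG DUALITY AT EVERY FIELD.** For every interior filling `0 < ρ < 2` there is a chemical potential `μ`
with `e_src(t',U,μ,h) + μρ = E_ρ(t',U,h)`: a supporting slope `μ` of the convex `E_·(t',U,h)` at `ρ` (realised
densities on both sides) satisfies `E_m − μm ≥ E_ρ − μρ` at every realised `m`, so `E_ρ − μρ ≤ inf_m (E_m − μm) =
e_src(t',U,μ,h)`, and weak duality gives the reverse inequality. [cite: Rockafellar1970, Thm. 23.4] -/
theorem exists_dWaveSourceEnergyDensityTT'_add_mul_eq_tiGroundEnergyDensityAt {ρ : ℝ} (hρ0 : 0 < ρ)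
    (hρ2 : ρ < 2) :
    ∃ μ : ℝ, dWaveSourceEnergyDensityTT' t' U μ h + μ * ρ =
      (hubbardTTPrimeSourcedInteraction 1 t' U 0 dWaveFormFactor h).tiGroundEnergyDensityAt 1 ρ := by
  set D : Set ℝ := {m : ℝ | ∃ ω : InfVolFermionState 2, ω.IsTranslationInvariant ∧ ω.density = m} with hD
  set E : ℝ → ℝ := (hubbardTTPrimeSourcedInteraction 1 t' U 0 dWaveFormFactor h).tiGroundEnergyDensityAt 1
    with hE
  have hconv : ConvexOn ℝ D E :=
    (hubbardTTPrimeSourcedInteraction 1 t' U 0 dWaveFormFactor h).convexOn_tiGroundEnergyDensityAt_realised 1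
  have hρD : ρ ∈ D := mem_setOf_isTranslationInvariant_density_of_Ioo hρ0 hρ2
  -- realised densities on both sides of `ρ`, hence a supporting slope `μ` of the convex `E` at `ρ`
  obtain ⟨μ, hμ⟩ := hconv.exists_supporting_slope hρD
    ⟨ρ / 2, mem_setOf_isTranslationInvariant_density_of_Ioo (by linarith) (by linarith), by linarith⟩
    ⟨(ρ + 2) / 2, mem_setOf_isTranslationInvariant_density_of_Ioo (by linarith) (by linarith), by linarith⟩
  refine ⟨μ, le_antisymm (dWaveSourceEnergyDensityTT'_add_mul_le_tiGroundEnergyDensityAt t' U μ h hρD) ?_⟩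
  -- the supporting line is a floor at every filling, so `E ρ − μρ ≤ e_src(μ)`
  have h2 := le_dWaveSourceEnergyDensityTT'_of_forall_density_floor t' U μ h (c := E ρ - μ * ρ)
    fun m hm => by have h1 := hμ m hm; linarith
  change E ρ ≤ dWaveSourceEnergyDensityTT' t' U μ h + μ * ρ
  linarith

/-- **`E_ρ(t',U,h) = max_μ (e_src(t',U,μ,h) + μρ)`** at every interior filling (the supremum is attained).
[cite: Ruelle1969, §3.4] -/
theorem isGreatest_dWaveSourceEnergyDensityTT'_add_mul {ρ : ℝ} (hρ0 : 0 < ρ) (hρ2 : ρ < 2) :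
    IsGreatest {x : ℝ | ∃ μ : ℝ, x = dWaveSourceEnergyDensityTT' t' U μ h + μ * ρ}
      ((hubbardTTPrimeSourcedInteraction 1 t' U 0 dWaveFormFactor h).tiGroundEnergyDensityAt 1 ρ) := by
  obtain ⟨μ, hμ⟩ := exists_dWaveSourceEnergyDensityTT'_add_mul_eq_tiGroundEnergyDensityAt t' U h hρ0 hρ2
  refine ⟨⟨μ, hμ.symm⟩, ?_⟩
  rintro x ⟨μ', rfl⟩
  exact dWaveSourceEnergyDensityTT'_add_mul_le_tiGroundEnergyDensityAt t' U μ' h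
    (mem_setOf_isTranslationInvariant_density_of_Ioo hρ0 hρ2)

/-- **Supremum form**: `E_ρ(t',U,h) = ⨆_μ (e_src(t',U,μ,h) + μρ)` for `0 < ρ < 2`. [cite: Ruelle1969, §3.4] -/
theorem tiGroundEnergyDensityAt_sourced_eq_ciSup {ρ : ℝ} (hρ0 : 0 < ρ) (hρ2 : ρ < 2) :
    (hubbardTTPrimeSourcedInteraction 1 t' U 0 dWaveFormFactor h).tiGroundEnergyDensityAt 1 ρ =
      ⨆ μ : ℝ, (dWaveSourceEnergyDensityTT' t' U μ h + μ * ρ) := by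
  have hG := isGreatest_dWaveSourceEnergyDensityTT'_add_mul t' U h hρ0 hρ2
  have hG' : IsGreatest (Set.range fun μ : ℝ => dWaveSourceEnergyDensityTT' t' U μ h + μ * ρ)
      ((hubbardTTPrimeSourcedInteraction 1 t' U 0 dWaveFormFactor h).tiGroundEnergyDensityAt 1 ρ) := by
    refine ⟨?_, ?_⟩
    · obtain ⟨μ, hμ⟩ := hG.1
      exact ⟨μ, hμ.symm⟩
    · rintro x ⟨μ, rfl⟩
      exact hG.2 ⟨μ, rfl⟩
  exact (hG'.csSup_eq).symm

/-- **A canonical-class FLOOR at an interior filling from grand-canonical data is SHARP for some `μ`**: if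
`lo_μ ≤ e_src(t',U,μ,h)` were known exactly for all `μ`, the best canonical floor `sup_μ (lo_μ + μρ)` would equal
`E_ρ(t',U,h)`; in certified practice: for every `ε > 0` some `μ` has `E_ρ(t',U,h) − ε < e_src(t',U,μ,h) + μρ`.
[cite: Ruelle1969, §3.4] -/
theorem exists_tiGroundEnergyDensityAt_sub_lt_dWaveSourceEnergyDensityTT'_add_mul {ρ : ℝ} (hρ0 : 0 < ρ)
    (hρ2 : ρ < 2) {ε : ℝ} (hε : 0 < ε) :
    ∃ μ : ℝ, (hubbardTTPrimeSourcedInteraction 1 t' U 0 dWaveFormFactor h).tiGroundEnergyDensityAt 1 ρ - ε <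
      dWaveSourceEnergyDensityTT' t' U μ h + μ * ρ := by
  obtain ⟨μ, hμ⟩ := exists_dWaveSourceEnergyDensityTT'_add_mul_eq_tiGroundEnergyDensityAt t' U h hρ0 hρ2
  exact ⟨μ, by linarith⟩

end StrongDuality

/-! ### §3 Consistency at zero source -/

section ZeroSource

/-- At `μ = 0 = h` the sourced interaction is the plain `t–t'` Hubbard interaction. [cite: KomaTasaki1994, §1] -/
theorem hubbardTTPrimeSourcedInteraction_zero_mu_zero_source (t t' U : ℝ) (g : Site 2 → ℝ) :
    hubbardTTPrimeSourcedInteraction t t' U 0 g 0 = hubbardTTPrimeFermionInteraction t t' U := by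
  refine FermionInteraction.ext fun X => ?_
  simp only [hubbardTTPrimeSourcedInteraction, hubbardTTPrimeMuInteraction, FermionInteraction.pencil_apply,
    neg_zero, Complex.ofReal_zero, zero_smul, add_zero]

/-- **At zero source the canonical-class value is Ruelle's canonical energy density**:
`E_ρ(t',U,0) = energyDensityTT' 1 t' U ρ` (`U ≥ 0`, `0 < ρ < 2`). [cite: Ruelle1969, §3.4] -/
theorem tiGroundEnergyDensityAt_sourced_zero_eq_energyDensityTT' (t' : ℝ) {U : ℝ} (hU : 0 ≤ U) {ρ : ℝ}
    (hρ0 : 0 < ρ) (hρ2 : ρ < 2) :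
    (hubbardTTPrimeSourcedInteraction 1 t' U 0 dWaveFormFactor 0).tiGroundEnergyDensityAt 1 ρ =
      energyDensityTT' 1 t' U ρ := by
  rw [hubbardTTPrimeSourcedInteraction_zero_mu_zero_source]
  exact tiGroundEnergyDensityAt_hubbardTTPrime_eq_energyDensityTT' 1 t' hU hρ0 hρ2

/-- Consistency: at `h = 0` the strong duality of §2 is the tree's Fenchel–Moreau for the canonical energy density,
`∃ μ, e_src(t',U,μ,0) + μρ = energyDensityTT' 1 t' U ρ` (`U ≥ 0`, `0 < ρ < 2`). [cite: Ruelle1969, §3.4] -/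
theorem exists_dWaveSourceEnergyDensityTT'_zero_add_mul_eq_energyDensityTT' (t' : ℝ) {U : ℝ} (hU : 0 ≤ U)
    {ρ : ℝ} (hρ0 : 0 < ρ) (hρ2 : ρ < 2) :
    ∃ μ : ℝ, dWaveSourceEnergyDensityTT' t' U μ 0 + μ * ρ = energyDensityTT' 1 t' U ρ := by
  rw [← tiGroundEnergyDensityAt_sourced_zero_eq_energyDensityTT' t' hU hρ0 hρ2]
  exact exists_dWaveSourceEnergyDensityTT'_add_mul_eq_tiGroundEnergyDensityAt t' U 0 hρ0 hρ2

end ZeroSource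

end Literature.MathematicalPhysics.QuantumLattice

end
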